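import Summits.CriticalPhenomena.PercolationContinuityZ3.Theorems.PercNearOneGluingAdditiveGluingCAG
import HarnessLib

/-!
# Crux `PercNearOneGluing.AdditiveGluing` (stmt-CriticalPhenomena-4576): the PEEL IDENTITY for set-gluing gains

Support file (`--supports stmt-CriticalPhenomena-4576`; lead-of-record prim-png-lead-4576, gen 2).  No definitions, no named facts, no sorries.
Companion of the set-gluing reduction (`…SetGlueK0.lean`, `…SetGlueHalf.lean`, skeleton v22: the crux ⟸ the set kernel (K₀-set),
registered stubs `stub_k0_dp` (|S| = 2) and `stub_k0set3_g2` (|S| ≥ 3)).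

For a finite relay set `S`, a target `b` and a vertex `x`, the exact gain of `x` from gluing `S` into one vertex is the event
`Γ_x(S) = {x ↮ b} ∩ (⋃_{t∈S} x↔t) ∩ (⋃_{t∈S} t↔b)`.  Peeling one relay `s ∈ S`, `R = S ∖ {s}`, `D = {s ↮ R} = (⋃_{r∈R} s↔r)ᶜ`:

* `setGlue_gain_peel` — **`μ(Γ_x(S)) = μ(D ∩ x↔s ∩ R↔b) + μ(D ∩ x↔R ∩ s↔b) + μ(Γ_x(R))`**: the gain from gluing `S` is the gain from gluing `R`
  plus the two "pair-type" terms in which the clusters of `s` and of `R` are separated and `x`, `b` sit on opposite sides (exactly the shape of the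
  pair kernel (K₀) / the covariance transfer (T) with the pair `(s, R)`, `R` entering through the union of its clusters).  Event-level statement
  `setGlue_gain_peel_set` (disjoint union) + measure additivity.
This is the identity behind the recursion analysed in the lead's memo (HOME `LeadMath-g2.md` §7–§8: the natural set-pair kernel holds numerically
but pair-step chains leak a small budget, so (K₀-set) has to be proved |S|-uniformly); it is recorded here as the common first line of any
inductive treatment of (K₀-set). [cite: KozmaNitzan2024, Lemma 4 / (8)–(9) (pp. 9–10), §5.3 (p. 34)]
-/

namespace Summit.CriticalPhenomena.PercolationContinuityZ3.Theorems

open MeasureTheory Set Literature.Probability.LatticeModels Literature.Probability.Percolation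

noncomputable section
open Classical

variable {n : ℕ}

/-- **Peel identity, event form.**  With `R = S.erase s` (`s ∈ S`) and `D = (⋃_{r∈R} s↔r)ᶜ`, the gain event of `x` for `S` is the union of
`D ∩ x↔s ∩ (⋃_{r∈R} r↔b)`, `D ∩ (⋃_{r∈R} x↔r) ∩ s↔b` and the gain event of `x` for `R`. [folklore] -/
theorem setGlue_gain_peel_set (S : Finset (Fin n)) {s : Fin n} (hs : s ∈ S) (x b : Fin n) :
    ((openConn x b)ᶜ ∩ (⋃ t ∈ S, (openConn x t : Set (BondConfig (Fin n)))) ∩ (⋃ t ∈ S, (openConn t b : Set (BondConfig (Fin n))))) =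
      ((⋃ r ∈ S.erase s, (openConn s r : Set (BondConfig (Fin n))))ᶜ ∩ openConn x s ∩
          (⋃ r ∈ S.erase s, (openConn r b : Set (BondConfig (Fin n))))) ∪
        ((⋃ r ∈ S.erase s, (openConn s r : Set (BondConfig (Fin n))))ᶜ ∩
            (⋃ r ∈ S.erase s, (openConn x r : Set (BondConfig (Fin n)))) ∩ openConn s b) ∪
        ((openConn x b)ᶜ ∩ (⋃ r ∈ S.erase s, (openConn x r : Set (BondConfig (Fin n)))) ∩
          (⋃ r ∈ S.erase s, (openConn r b : Set (BondConfig (Fin n))))) := by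
  ext ω
  simp only [Set.mem_inter_iff, Set.mem_compl_iff, Set.mem_union, Set.mem_iUnion, exists_prop, Finset.mem_erase]
  have tr : ∀ {p q r : Fin n}, ω ∈ (openConn p q : Set (BondConfig (Fin n))) → ω ∈ (openConn q r : Set (BondConfig (Fin n))) →
      ω ∈ (openConn p r : Set (BondConfig (Fin n))) := fun h h' => SimpleGraph.Reachable.trans h h'
  have sy : ∀ {p q : Fin n}, ω ∈ (openConn p q : Set (BondConfig (Fin n))) → ω ∈ (openConn q p : Set (BondConfig (Fin n))) :=
    fun h => SimpleGraph.Reachable.symm h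
  constructor
  · rintro ⟨⟨hxb, ⟨t, ht, hxt⟩⟩, ⟨t', ht', htb⟩⟩
    by_cases hD : ∃ r, (r ≠ s ∧ r ∈ S) ∧ ω ∈ (openConn s r : Set (BondConfig (Fin n)))
    · -- `s ↔ R`: everything routes through `R`
      obtain ⟨r₀, ⟨hr₀s, hr₀S⟩, hsr₀⟩ := hD
      right
      refine ⟨⟨hxb, ?_⟩, ?_⟩
      · by_cases hts : t = s
        · subst hts; exact ⟨r₀, ⟨hr₀s, hr₀S⟩, tr hxt hsr₀⟩
        · exact ⟨t, ⟨hts, ht⟩, hxt⟩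
      · by_cases ht's : t' = s
        · subst ht's; exact ⟨r₀, ⟨hr₀s, hr₀S⟩, tr (sy hsr₀) htb⟩
        · exact ⟨t', ⟨ht's, ht'⟩, htb⟩
    · by_cases hts : t = s
      · subst hts
        by_cases ht's : t' = t
        · subst ht's; exact absurd (tr hxt htb) hxb
        · left; left
          exact ⟨⟨hD, hxt⟩, ⟨t', ⟨ht's, ht'⟩, htb⟩⟩
      · by_cases ht's : t' = s
        · subst ht's
          left; right
          exact ⟨⟨hD, ⟨t, ⟨hts, ht⟩, hxt⟩⟩, htb⟩
        · right
          exact ⟨⟨hxb, ⟨t, ⟨hts, ht⟩, hxt⟩⟩, ⟨t', ⟨ht's, ht'⟩, htb⟩⟩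
  · rintro ((⟨⟨hD, hxs⟩, ⟨r, ⟨hrs, hrS⟩, hrb⟩⟩ | ⟨⟨hD, ⟨r, ⟨hrs, hrS⟩, hxr⟩⟩, hsb⟩) | ⟨⟨hxb, ⟨r, ⟨hrs, hrS⟩, hxr⟩⟩, ⟨r', ⟨hr's, hr'S⟩, hr'b⟩⟩)
    · refine ⟨⟨fun hxb => hD ⟨r, ⟨hrs, hrS⟩, tr (tr (sy hxs) hxb) (sy hrb)⟩, ⟨s, hs, hxs⟩⟩, ⟨r, hrS, hrb⟩⟩
    · refine ⟨⟨fun hxb => hD ⟨r, ⟨hrs, hrS⟩, tr (tr hsb (sy hxb)) hxr⟩, ⟨r, hrS, hxr⟩⟩, ⟨s, hs, hsb⟩⟩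
    · exact ⟨⟨hxb, ⟨r, hrS, hxr⟩⟩, ⟨r', hr'S, hr'b⟩⟩

/-- **Peel identity for the set-gluing gain** (file header): for `s ∈ S`, `R = S.erase s`, `D = {s ↮ R}`,
`μ(Γ_x(S)) = μ(D ∩ x↔s ∩ R↔b) + μ(D ∩ x↔R ∩ s↔b) + μ(Γ_x(R))`. [folklore] -/
theorem setGlue_gain_peel (w : Sym2 (Fin n) → unitInterval) (S : Finset (Fin n)) {s : Fin n} (hs : s ∈ S) (x b : Fin n) :
    (prodBernoulli w).real ((openConn x b)ᶜ ∩ (⋃ t ∈ S, (openConn x t : Set (BondConfig (Fin n)))) ∩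
        (⋃ t ∈ S, (openConn t b : Set (BondConfig (Fin n))))) =
      (prodBernoulli w).real ((⋃ r ∈ S.erase s, (openConn s r : Set (BondConfig (Fin n))))ᶜ ∩ openConn x s ∩
          (⋃ r ∈ S.erase s, (openConn r b : Set (BondConfig (Fin n))))) +
        (prodBernoulli w).real ((⋃ r ∈ S.erase s, (openConn s r : Set (BondConfig (Fin n))))ᶜ ∩
            (⋃ r ∈ S.erase s, (openConn x r : Set (BondConfig (Fin n)))) ∩ openConn s b) +
        (prodBernoulli w).real ((openConn x b)ᶜ ∩ (⋃ r ∈ S.erase s, (openConn x r : Set (BondConfig (Fin n)))) ∩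
          (⋃ r ∈ S.erase s, (openConn r b : Set (BondConfig (Fin n))))) := by
  have hm : ∀ s : Set (BondConfig (Fin n)), MeasurableSet s := fun _ => MeasurableSet.of_discrete
  rw [setGlue_gain_peel_set S hs x b]
  set E₁ : Set (BondConfig (Fin n)) := (⋃ r ∈ S.erase s, (openConn s r : Set (BondConfig (Fin n))))ᶜ ∩ openConn x s ∩
      (⋃ r ∈ S.erase s, (openConn r b : Set (BondConfig (Fin n)))) with hE₁
  set E₂ : Set (BondConfig (Fin n)) := (⋃ r ∈ S.erase s, (openConn s r : Set (BondConfig (Fin n))))ᶜ ∩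
      (⋃ r ∈ S.erase s, (openConn x r : Set (BondConfig (Fin n)))) ∩ openConn s b with hE₂
  set E₃ : Set (BondConfig (Fin n)) := (openConn x b)ᶜ ∩ (⋃ r ∈ S.erase s, (openConn x r : Set (BondConfig (Fin n)))) ∩
      (⋃ r ∈ S.erase s, (openConn r b : Set (BondConfig (Fin n)))) with hE₃
  have tr : ∀ {ω : BondConfig (Fin n)} {p q r : Fin n}, ω ∈ (openConn p q : Set (BondConfig (Fin n))) →
      ω ∈ (openConn q r : Set (BondConfig (Fin n))) → ω ∈ (openConn p r : Set (BondConfig (Fin n))) :=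
    fun h h' => SimpleGraph.Reachable.trans h h'
  have sy : ∀ {ω : BondConfig (Fin n)} {p q : Fin n}, ω ∈ (openConn p q : Set (BondConfig (Fin n))) →
      ω ∈ (openConn q p : Set (BondConfig (Fin n))) := fun h => SimpleGraph.Reachable.symm h
  have h12 : Disjoint E₁ E₂ := by
    rw [Set.disjoint_left]
    rintro ω ⟨⟨hD, hxs⟩, _⟩ ⟨⟨_, hxR⟩, _⟩
    simp only [Set.mem_iUnion, exists_prop] at hxR
    simp only [Set.mem_compl_iff, Set.mem_iUnion, exists_prop, not_exists, not_and] at hD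
    obtain ⟨r, hr, hxr⟩ := hxR
    exact hD r hr (tr (sy hxs) hxr)
  have h13 : Disjoint E₁ E₃ := by
    rw [Set.disjoint_left]
    rintro ω ⟨⟨hD, hxs⟩, _⟩ ⟨⟨_, hxR⟩, _⟩
    simp only [Set.mem_iUnion, exists_prop] at hxR
    simp only [Set.mem_compl_iff, Set.mem_iUnion, exists_prop, not_exists, not_and] at hD
    obtain ⟨r, hr, hxr⟩ := hxR
    exact hD r hr (tr (sy hxs) hxr)
  have h23 : Disjoint E₂ E₃ := by
    rw [Set.disjoint_left]
    rintro ω ⟨⟨hD, _⟩, hsb⟩ ⟨_, hRb⟩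
    simp only [Set.mem_iUnion, exists_prop] at hRb
    simp only [Set.mem_compl_iff, Set.mem_iUnion, exists_prop, not_exists, not_and] at hD
    obtain ⟨r, hr, hrb⟩ := hRb
    exact hD r hr (tr hsb (sy hrb))
  rw [measureReal_union (Disjoint.union_left h13 h23) (hm _), measureReal_union h12 (hm _)]

end

end Summit.CriticalPhenomena.PercolationContinuityZ3.Theorems
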